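import Summits.HodgeConjecture.CorCM.Census.OddSliceFacesModel

/-!
# Rank-four faces of the Galois CM type `(ℤ/2 × A, (1,0))` in the representative-free labelling: corners, face classes are Hodge,
# Galois translates of faces, the type square as a second difference modulo pairs; normalisation, simple factors, defect classes

COR-CM (cell `pub-hodgecm2`), count-neutral kernel census by the binder seat b09 (gen 26; lane ODD-SLICE-FACES, part II of
`OddSliceFacesModel` → `OddSliceFacesSquares` → `OddSliceFacesDescent` → `OddSliceFacesGenerate` → `OddSliceFacesCount` → `OddSliceFacesRecord`; the statements
and proofs are those of gen 25's `Census/CyclicPrimeTypeSquares.lean` with `ℤ/p` replaced by a finite abelian group `A`, `p ≠ 2`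
replaced by `|A|` odd, and b17's `Orbits p` replaced by b17's `OrbitsA A`).  Bookkeeping definitions (`faceVec`, `nrm`, `clsTy`, `cls`,
`rep`) + theorems in the model of part I; no `decide` table, no certificate, no named fact, no geometry, no `sorry`.  HC_CM is not
proved anywhere in this cell; nothing here is a headline and nothing here produces a period.

CONTENT (dictionary of part I).  A rank-four FACE of `F` is `(φ; i, j)`: a CM type `φ : A → ℤ/2` and two distinct places `i ≠ j ∈ A`
(the places of the CM field `F`, `Gal(F/ℚ) = ℤ/2 × A`, over `k = F^A` are the elements of `A`); its four CORNERS are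
`φ, φ̄^{(i)} = φ + 1 + δ i, φ̄^{(j)} = φ + 1 + δ j, φ^{(ij)} = φ + δ i + δ j` (verbatim rfwf Def. 1.1 / the tree's `Face.corner` read in
the model; b30's `Census/FaceSquaresModel.corners`), and its FACE CLASS `faceVec` is the indicator of the corner set = the exponent
vector of the `1`-eigencomponent of the Weil line `W_F(P(f))` of the corner product (the other eigencomponents are its Galois
translates `transl g`).  **`faceVec_mem`**: every face class is a Hodge vector (rfwf Lemma 1.2 `SumTwo`: every embedding lies in
exactly two corners, so every Pohlmann form vanishes); **`transl_faceVec`**: the Galois translate by `g = (a, t)` of the class of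
`(φ; i, j)` is the class of `(tw g φ; i − t, j − t)`; **`faceVec_ind_sub_mem_pairs`** (THE TYPE SQUARE): for `i ≠ j ∈ Q` the class of
`(𝟙_Q; i, j)` is, modulo pairs, the second difference `e_{𝟙_Q} − e_{𝟙_{Q∖i}} − e_{𝟙_{Q∖j}} + e_{𝟙_{Q∖{i,j}}}`; corner weights
`wt φ̄^{(i)} = |A| − wt φ + 1`, `wt φ^{(ij)} = wt φ − 2`, `wt (φ̄^{(i)} + 1) = wt φ − 1` through defects `φ i = φ j = 1`.
§2 (`|A|` ODD).  NORMALISATION: exactly one of `ψ`, `ψ + 1` has weight `≤ |A|/2`; `nrm m` moves every coefficient onto the normalised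
label of its pair (`sub_nrm_mem_pairs`, `wt_le_of_nrm_ne_zero`).  THE SIMPLE FACTORS other than `E` = b17's `OddDegreeParityLaw.OrbitsA A`
(the `G`-orbits of nonconstant types; `#orbits · 2|A| = Σ_y (2^{|A/ℤy|} − 2)`, b17's `card_orbitsA_mul`); b17's action is the twist
(`vadd_val_eq_tw`); the DEFECT CLASS `cls ω = min (wt, |A| − wt)` of a simple factor (`1 ≤ cls ω ≤ |A|/2`, `cls_mk`), its normalised
representative type `rep ω` (`wt_rep : wt (rep ω) = cls ω`), and **`exists_tw_rep`**: every normalised nonconstant type is a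
`(0,t)`-translate of the representative of its factor.  All [folklore].

## References
* [Pohlmann1968] H. Pohlmann, Algebraic cycles on abelian varieties of complex multiplication type, Ann. of Math. 88 (1968), Thm 1.
* [Milne1999] J. S. Milne, Lefschetz motives and the Tate conjecture, Compositio Math. 117 (1999), Prop. 2.1, p. 54.
* [Weil1977HodgeRing] A. Weil, Abelian varieties and the Hodge ring, Œuvres Scientifiques III, [1977c], 421–429.
-/

namespace Summit.HodgeConjecture.CorCM.Census.OddSliceFacesSquares

open Finset
open Summit.HodgeConjecture.CorCM.Census.OddSliceFacesModel

section Faces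

variable (A : Type) [AddCommGroup A] [Fintype A] [DecidableEq A]

/-! ## §1 Faces, corners, face classes -/

/-- **The face class** of the rank-four face `(φ; i, j)`: the indicator of its four corners
`φ, φ̄^{(i)} = φ + 1 + δ i, φ̄^{(j)} = φ + 1 + δ j, φ^{(ij)} = φ + δ i + δ j` (exponent vector of the `1`-eigencomponent of the
Weil line of the face). [folklore] -/
def faceVec (φ : Ty A) (i j : A) : Ty A → ℤ :=
  Pi.single φ 1 + Pi.single (φ + 1 + δ A i) 1 + Pi.single (φ + 1 + δ A j) 1 + Pi.single (φ + δ A i + δ A j) 1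

omit [AddCommGroup A] in
/-- The form of `(0, t)` on a face class, corner by corner. [folklore] -/
theorem coef_zero_dotProduct_faceVec (t : A) (φ : Ty A) (i j : A) :
    coef A (0, t) ⬝ᵥ faceVec A φ i j =
      (if φ t = 0 then 1 else -1) + (if (φ + 1 + δ A i) t = 0 then 1 else -1) +
        (if (φ + 1 + δ A j) t = 0 then 1 else -1) + (if (φ + δ A i + δ A j) t = 0 then 1 else -1) := by
  unfold faceVec
  rw [dotProduct_add, dotProduct_add, dotProduct_add, coef_zero_dotProduct_single, coef_zero_dotProduct_single,
    coef_zero_dotProduct_single, coef_zero_dotProduct_single]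
  ring

omit [AddCommGroup A] in
/-- **Face classes are Hodge vectors** (`SumTwo`: every embedding lies in exactly two corners). [folklore] -/
theorem faceVec_mem (φ : Ty A) {i j : A} (hij : i ≠ j) : faceVec A φ i j ∈ hodge A := by
  rw [mem_hodge_iff]
  intro t
  rw [coef_zero_dotProduct_faceVec]
  simp only [Pi.add_apply, Pi.one_apply, delta_apply]
  have key0 : ∀ u : ZMod 2, (if u = 0 then (1 : ℤ) else -1) + (if u + 1 + 0 = 0 then (1 : ℤ) else -1) +
      (if u + 1 + 0 = 0 then (1 : ℤ) else -1) + (if u + 0 + 0 = 0 then (1 : ℤ) else -1) = 0 := by decide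
  have key1 : ∀ u : ZMod 2, (if u = 0 then (1 : ℤ) else -1) + (if u + 1 + 1 = 0 then (1 : ℤ) else -1) +
      (if u + 1 + 0 = 0 then (1 : ℤ) else -1) + (if u + 1 + 0 = 0 then (1 : ℤ) else -1) = 0 := by decide
  have key2 : ∀ u : ZMod 2, (if u = 0 then (1 : ℤ) else -1) + (if u + 1 + 0 = 0 then (1 : ℤ) else -1) +
      (if u + 1 + 1 = 0 then (1 : ℤ) else -1) + (if u + 0 + 1 = 0 then (1 : ℤ) else -1) = 0 := by decide
  by_cases hti : t = i
  · subst hti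
    rw [if_pos rfl, if_neg hij]
    exact key1 (φ t)
  · by_cases htj : t = j
    · subst htj
      rw [if_pos rfl, if_neg hti]
      exact key2 (φ t)
    · rw [if_neg hti, if_neg htj]
      exact key0 (φ t)

/-- **A Galois translate of a face class is the face class of the translated face.** [folklore] -/
theorem transl_faceVec (g : ZMod 2 × A) (φ : Ty A) (i j : A) :
    transl A g (faceVec A φ i j) = faceVec A (tw A g φ) (i - g.2) (j - g.2) := by
  rw [← translHom_apply, faceVec, map_add, map_add, map_add]
  simp only [translHom_apply, transl_single, tw_add_delta, tw_add_one]
  rfl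

omit [AddCommGroup A] in
/-- **The type square.**  For `i ≠ j` in `Q`, the face class of `(𝟙_Q; i, j)` is, modulo pairs, the second difference
`e_{𝟙_Q} − e_{𝟙_{Q∖i}} − e_{𝟙_{Q∖j}} + e_{𝟙_{Q∖{i,j}}}`. [folklore] -/
theorem faceVec_ind_sub_mem_pairs {Q : Finset (A)} {i j : A} (hi : i ∈ Q) (hj : j ∈ Q) (hij : i ≠ j) :
    faceVec A (ind A Q) i j - (Pi.single (ind A Q) 1 - Pi.single (ind A (Q.erase i)) 1 - Pi.single (ind A (Q.erase j)) 1
      + Pi.single (ind A ((Q.erase i).erase j)) 1) ∈ pairs A := by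
  have hj' : j ∈ Q.erase i := Finset.mem_erase.mpr ⟨Ne.symm hij, hj⟩
  have h1 : ind A Q + 1 + δ A i = ind A (Q.erase i) + 1 := by rw [add_right_comm, ind_add_delta A hi]
  have h2 : ind A Q + 1 + δ A j = ind A (Q.erase j) + 1 := by rw [add_right_comm, ind_add_delta A hj]
  have h3 : ind A Q + δ A i + δ A j = ind A ((Q.erase i).erase j) := by rw [ind_add_delta A hi, ind_add_delta A hj']
  unfold faceVec
  rw [h1, h2, h3, single_add_one, single_add_one]
  have : (Pi.single (ind A Q) 1 + (pairVec A (ind A (Q.erase i)) - Pi.single (ind A (Q.erase i)) 1) +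
        (pairVec A (ind A (Q.erase j)) - Pi.single (ind A (Q.erase j)) 1) +
        Pi.single (ind A ((Q.erase i).erase j)) 1 -
      (Pi.single (ind A Q) 1 - Pi.single (ind A (Q.erase i)) 1 - Pi.single (ind A (Q.erase j)) 1 +
        Pi.single (ind A ((Q.erase i).erase j)) 1) : Ty A → ℤ) =
      pairVec A (ind A (Q.erase i)) + pairVec A (ind A (Q.erase j)) := by abel
  rw [this]
  exact Submodule.add_mem _ (Submodule.subset_span ⟨_, rfl⟩) (Submodule.subset_span ⟨_, rfl⟩)

omit [AddCommGroup A] in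
/-- Weights of the corners of a face `(φ; i, j)` through a defect `φ i = 1`: `wt φ̄^{(i)} = |A| − wt φ + 1`. [folklore] -/
theorem wt_corner_bar {φ : Ty A} {i : A} (hi : φ i = 1) : wt A (φ + 1 + δ A i) = Fintype.card A - wt A φ + 1 := by
  set Q := univ.filter fun s => φ s = 1 with hQ
  have hφ : φ = ind A Q := (ind_filter A φ).symm
  have hiQ : i ∈ Q := by rw [hQ]; simp [hi]
  have h1 : φ + 1 + δ A i = ind A (Q.erase i) + 1 := by rw [hφ, add_right_comm, ind_add_delta A hiQ]
  rw [h1, wt_add_one, wt_ind, hφ, wt_ind, Finset.card_erase_of_mem hiQ]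
  have hc : Q.card ≤ Fintype.card A := by rw [← wt_ind A Q]; exact wt_le A _
  have hpos : 0 < Q.card := Finset.card_pos.mpr ⟨i, hiQ⟩
  omega

omit [AddCommGroup A] in
/-- Weights of the corners, continued: `wt φ^{(ij)} = wt φ − 2` for two defects `i ≠ j`. [folklore] -/
theorem wt_corner_flip {φ : Ty A} {i j : A} (hi : φ i = 1) (hj : φ j = 1) (hij : i ≠ j) :
    wt A (φ + δ A i + δ A j) = wt A φ - 2 := by
  set Q := univ.filter fun s => φ s = 1 with hQ
  have hφ : φ = ind A Q := (ind_filter A φ).symm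
  have hiQ : i ∈ Q := by rw [hQ]; simp [hi]
  have hjQ : j ∈ Q.erase i := Finset.mem_erase.mpr ⟨Ne.symm hij, by rw [hQ]; simp [hj]⟩
  have h1 : φ + δ A i + δ A j = ind A ((Q.erase i).erase j) := by rw [hφ, ind_add_delta A hiQ, ind_add_delta A hjQ]
  rw [h1, wt_ind, hφ, wt_ind, Finset.card_erase_of_mem hjQ, Finset.card_erase_of_mem hiQ]
  omega

omit [AddCommGroup A] in
/-- The conjugate of the corner `φ̄^{(i)}` is `φ^{(i)} = φ + δ i`, of weight `wt φ − 1`. [folklore] -/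
theorem wt_corner_bar_add_one {φ : Ty A} {i : A} (hi : φ i = 1) : wt A (φ + 1 + δ A i + 1) = wt A φ - 1 := by
  set Q := univ.filter fun s => φ s = 1 with hQ
  have hφ : φ = ind A Q := (ind_filter A φ).symm
  have hiQ : i ∈ Q := by rw [hQ]; simp [hi]
  have h11 : (1 : Ty A) + 1 = 0 := by funext s; exact (by decide : (1 : ZMod 2) + 1 = 0)
  have h1 : φ + 1 + δ A i + 1 = φ + δ A i := by
    rw [add_right_comm φ 1 (δ A i), add_assoc, h11, add_zero]
  rw [h1, hφ, ind_add_delta A hiQ, wt_ind, wt_ind, Finset.card_erase_of_mem hiQ]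

end Faces

/-! ## §2 Odd order: normalisation modulo pairs, simple factors, defect classes -/

section Odd

variable (A : Type) [AddCommGroup A] [Fintype A] [DecidableEq A]

/-! ### §2.1 Normalisation modulo pairs -/

omit [AddCommGroup A] [DecidableEq A] in
/-- A label is normalised when its weight is at most `|A|/2`; for `|A|` odd the conjugate of a normalised label is not. [folklore] -/
theorem not_wt_add_one_le (hA : Odd (Fintype.card A)) {ψ : Ty A} (h : wt A ψ ≤ Fintype.card A / 2) : ¬ wt A (ψ + 1) ≤ Fintype.card A / 2 := by
  rw [wt_add_one]
  have hodd2 : Fintype.card A % 2 = 1 := Nat.odd_iff.mp hA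
  omega

omit [AddCommGroup A] [DecidableEq A] in
/-- Conversely, if `ψ` is not normalised then `ψ + 1` is. [folklore] -/
theorem wt_add_one_le (hA : Odd (Fintype.card A)) {ψ : Ty A} (h : ¬ wt A ψ ≤ Fintype.card A / 2) : wt A (ψ + 1) ≤ Fintype.card A / 2 := by
  rw [wt_add_one]
  have hodd2 : Fintype.card A % 2 = 1 := Nat.odd_iff.mp hA
  have := wt_le A ψ
  omega

/-- Normalisation: move every coefficient onto the normalised label of its conjugate pair. [folklore] -/
def nrm (m : Ty A → ℤ) : Ty A → ℤ := fun ψ => if wt A ψ ≤ Fintype.card A / 2 then m ψ - m (ψ + 1) else 0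

omit [AddCommGroup A] [DecidableEq A] in
/-- `nrm m` is supported on normalised labels. [folklore] -/
theorem wt_le_of_nrm_ne_zero (m : Ty A → ℤ) {χ : Ty A} (h : nrm A m χ ≠ 0) : wt A χ ≤ Fintype.card A / 2 := by
  by_contra hc
  exact h (by simp [nrm, hc])

omit [AddCommGroup A] in
/-- `m − nrm m` is the sum of the pairs through the non-normalised labels. [folklore] -/
theorem sub_nrm_eq (hA : Odd (Fintype.card A)) (m : Ty A → ℤ) :
    m - nrm A m = ∑ ψ ∈ univ.filter (fun ψ => ¬ wt A ψ ≤ Fintype.card A / 2), m ψ • pairVec A ψ := by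
  funext χ
  rw [Pi.sub_apply, Finset.sum_apply]
  have hterm : ∀ ψ ∈ univ.filter (fun ψ : Ty A => ¬ wt A ψ ≤ Fintype.card A / 2), (m ψ • pairVec A ψ) χ =
      (if χ = ψ then m ψ else 0) + (if χ + 1 = ψ then m ψ else 0) := by
    intro ψ _
    have hc : (χ = ψ + 1) ↔ (χ + 1 = ψ) := by
      constructor
      · intro h; rw [h, add_one_add_one]
      · intro h; rw [← h, add_one_add_one]
    simp only [pairVec, Pi.smul_apply, Pi.add_apply, smul_eq_mul, Pi.single_apply, hc]
    split_ifs <;> ring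
  rw [Finset.sum_congr rfl hterm, Finset.sum_add_distrib, Finset.sum_ite_eq, Finset.sum_ite_eq]
  simp only [Finset.mem_filter, Finset.mem_univ, true_and, nrm]
  by_cases hχ : wt A χ ≤ Fintype.card A / 2
  · rw [if_pos hχ, if_neg (fun h => h hχ), if_pos (not_wt_add_one_le A hA hχ)]
    ring
  · rw [if_neg hχ, if_pos hχ, if_neg (fun h => h (wt_add_one_le A hA hχ))]
    ring

omit [AddCommGroup A] in
/-- `m − nrm m ∈ P`. [folklore] -/
theorem sub_nrm_mem_pairs (hA : Odd (Fintype.card A)) (m : Ty A → ℤ) : m - nrm A m ∈ pairs A := by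
  rw [sub_nrm_eq A hA]
  exact Submodule.sum_mem _ fun ψ _ => Submodule.smul_mem _ _ (Submodule.subset_span ⟨ψ, rfl⟩)

/-! ### §2.2 Simple factors (orbits), defect classes, normalised representatives -/

/-- The defect class of a type: `min (wt ψ) (|A| − wt ψ)`, an invariant of its `G`-orbit. [folklore] -/
def clsTy (ψ : Ty A) : ℕ := min (wt A ψ) (Fintype.card A - wt A ψ)

omit [DecidableEq A] in
/-- The defect class is `G`-invariant. [folklore] -/
theorem clsTy_tw (g : ZMod 2 × A) (ψ : Ty A) : clsTy A (tw A g ψ) = clsTy A ψ := by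
  obtain ⟨a, t⟩ := g
  unfold clsTy
  have h01 : ∀ u : ZMod 2, u = 0 ∨ u = 1 := by decide
  rcases h01 a with rfl | rfl
  · rw [wt_tw_zero]
  · rw [wt_tw_one]
    have := wt_le A ψ
    rw [Nat.sub_sub_self this, min_comm]

omit [Fintype A] [DecidableEq A] in
/-- b17's action on nonconstant types is the twist: `(g +ᵥ φ).1 = tw (g.1, −g.2) φ.1`. [folklore] -/
theorem vadd_val_eq_tw (g : ZMod 2 × A) (φ : OddDegreeParityLaw.Nonconst A) :
    (g +ᵥ φ).1 = tw A (g.1, -g.2) φ.1 := by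
  funext y
  rw [OddDegreeParityLaw.vadd_val]
  simp [tw, sub_eq_add_neg]

omit [Fintype A] [DecidableEq A] in
/-- Two nonconstant types in the same orbit are twists of each other. [folklore] -/
theorem exists_tw_of_mk_eq {φ ψ : OddDegreeParityLaw.Nonconst A}
    (h : (Quotient.mk _ φ : OddDegreeParityLaw.OrbitsA A) = Quotient.mk _ ψ) : ∃ g : ZMod 2 × A, tw A g ψ.1 = φ.1 := by
  have hrel : (AddAction.orbitRel (ZMod 2 × A) (OddDegreeParityLaw.Nonconst A)) φ ψ := Quotient.exact h
  obtain ⟨g, hg⟩ := AddAction.mem_orbit_iff.mp (AddAction.orbitRel_apply.mp hrel)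
  refine ⟨(g.1, -g.2), ?_⟩
  rw [← vadd_val_eq_tw, hg]

omit [DecidableEq A] in
/-- A type is nonconstant iff its weight is neither `0` nor `|A|`; the forward half. [folklore] -/
theorem nonconst_of_wt {ψ : Ty A} (h0 : 0 < wt A ψ) (h1 : wt A ψ < Fintype.card A) : ¬ ∀ y, ψ y = ψ 0 := by
  intro hc
  unfold wt at h0 h1
  have h01 : ∀ u : ZMod 2, u = 0 ∨ u = 1 := by decide
  rcases h01 (ψ 0) with hz | hz
  · have : (univ.filter fun s => ψ s = 1) = ∅ := by
      ext s
      simp only [Finset.mem_filter, Finset.mem_univ, true_and, Finset.notMem_empty, iff_false, hc s, hz]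
      decide
    rw [this, Finset.card_empty] at h0
    exact absurd h0 (lt_irrefl 0)
  · have : (univ.filter fun s => ψ s = 1) = univ := by
      ext s
      simp only [Finset.mem_filter, Finset.mem_univ, true_and, hc s, hz]
    rw [this, Finset.card_univ] at h1
    exact absurd h1 (lt_irrefl _)

omit [DecidableEq A] in
/-- The weight of a nonconstant type is neither `0` nor `|A|`. [folklore] -/
theorem wt_pos_of_nonconst {ψ : Ty A} (h : ¬ ∀ y, ψ y = ψ 0) : 0 < wt A ψ ∧ wt A ψ < Fintype.card A := by
  by_contra hc
  apply h
  have hcases : wt A ψ = 0 ∨ wt A ψ = Fintype.card A := by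
    have := wt_le A ψ
    omega
  unfold wt at hcases
  rcases hcases with h0 | h1
  · have hall : ∀ y, ψ y = 0 := by
      intro y
      have h01 : ∀ u : ZMod 2, u = 0 ∨ u = 1 := by decide
      rcases h01 (ψ y) with hy | hy
      · exact hy
      · have : y ∈ univ.filter fun s => ψ s = 1 := by simp [hy]
        rw [Finset.card_eq_zero.mp h0] at this
        exact absurd this (Finset.notMem_empty y)
    intro y; rw [hall y, hall 0]
  · have hall : ∀ y, ψ y = 1 := by
      intro y
      have huniv : (univ.filter fun s => ψ s = 1) = univ :=
        Finset.eq_univ_of_card _ (by rw [h1])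
      have : y ∈ univ.filter fun s => ψ s = 1 := by rw [huniv]; exact Finset.mem_univ y
      simpa using this
    intro y; rw [hall y, hall 0]

/-- The defect class of a simple factor (an orbit of nonconstant types). [folklore] -/
noncomputable def cls (ω : OddDegreeParityLaw.OrbitsA A) : ℕ := clsTy A (Quotient.out ω).1

omit [DecidableEq A] in
/-- The class of the orbit of `ψ` is the class of `ψ`. [folklore] -/
theorem cls_mk (ψ : OddDegreeParityLaw.Nonconst A) :
    cls A (Quotient.mk _ ψ : OddDegreeParityLaw.OrbitsA A) = clsTy A ψ.1 := by
  unfold cls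
  obtain ⟨g, hg⟩ := exists_tw_of_mk_eq A
    (Quotient.out_eq (Quotient.mk _ ψ : OddDegreeParityLaw.OrbitsA A))
  rw [← hg, clsTy_tw]

omit [DecidableEq A] in
/-- Every simple factor other than `E` has defect class between `1` and `|A|/2`. [folklore] -/
theorem one_le_cls (ω : OddDegreeParityLaw.OrbitsA A) : 1 ≤ cls A ω ∧ cls A ω ≤ Fintype.card A / 2 := by
  unfold cls clsTy
  have h := wt_pos_of_nonconst A (Quotient.out ω).2
  omega

/-- The normalised representative type of a simple factor: the chosen representative or its conjugate, whichever has weight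
`≤ |A|/2`. [folklore] -/
noncomputable def rep (ω : OddDegreeParityLaw.OrbitsA A) : Ty A :=
  if wt A (Quotient.out ω).1 ≤ Fintype.card A / 2 then (Quotient.out ω).1 else (Quotient.out ω).1 + 1

omit [DecidableEq A] in
/-- The representative is a twist of the chosen representative. [folklore] -/
theorem exists_tw_out_eq_rep (ω : OddDegreeParityLaw.OrbitsA A) : ∃ g : ZMod 2 × A, tw A g (Quotient.out ω).1 = rep A ω := by
  unfold rep
  split_ifs
  · exact ⟨0, tw_zero A _⟩
  · exact ⟨(1, 0), tw_one_zero A _⟩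

omit [DecidableEq A] in
/-- The weight of the representative is the defect class. [folklore] -/
theorem wt_rep (ω : OddDegreeParityLaw.OrbitsA A) : wt A (rep A ω) = cls A ω := by
  unfold rep cls clsTy
  have := wt_le A (Quotient.out ω).1
  split_ifs with h
  · omega
  · rw [wt_add_one]; omega

omit [DecidableEq A] in
/-- **Every normalised nonconstant type is a `(0,t)`-translate of the representative of its simple factor** (`|A|` odd).
[folklore] -/
theorem exists_tw_rep (hA : Odd (Fintype.card A)) (ψ : OddDegreeParityLaw.Nonconst A) (hψ : wt A ψ.1 ≤ Fintype.card A / 2) :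
    ∃ t : A, tw A (0, t) (rep A (Quotient.mk _ ψ : OddDegreeParityLaw.OrbitsA A)) = ψ.1 := by
  set ω : OddDegreeParityLaw.OrbitsA A := Quotient.mk _ ψ with hω
  obtain ⟨g₁, hg₁⟩ := exists_tw_of_mk_eq A (Quotient.out_eq ω)
  obtain ⟨g₂, hg₂⟩ := exists_tw_out_eq_rep A ω
  -- `rep ω = tw (g₂) (tw g₁ ψ) = tw (g₁ + g₂) ψ`
  have hrep : rep A ω = tw A (g₁ + g₂) ψ.1 := by rw [← hg₂, ← hg₁, tw_tw]
  have hwt : wt A (rep A ω) = cls A ω := wt_rep A ω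
  rw [hω, cls_mk] at hwt
  have h01 : ∀ u : ZMod 2, u = 0 ∨ u = 1 := by decide
  rcases h01 (g₁ + g₂).1 with h0 | h1
  · refine ⟨-(g₁ + g₂).2, ?_⟩
    rw [hrep, tw_tw]
    have : (g₁ + g₂) + (0, -(g₁ + g₂).2) = 0 := Prod.ext (by simpa using h0) (by simp)
    rw [this, tw_zero]
  · -- weight contradiction: `rep` and `ψ` are both normalised
    exfalso
    have hg : g₁ + g₂ = (1, (g₁ + g₂).2) := Prod.ext h1 rfl
    rw [hrep, hg, wt_tw_one] at hwt
    unfold clsTy at hwt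
    have hodd2 : Fintype.card A % 2 = 1 := Nat.odd_iff.mp hA
    have := wt_le A ψ.1
    omega

end Odd

end Summit.HodgeConjecture.CorCM.Census.OddSliceFacesSquares
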